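import Summits.SmoothPoincare4.SmoothPoincare4.Theses.OneStabInvertible

/-!
# OneStabInvertible — the split glue `InvertibleOfOneStab → InvertibleStandard → StabCancellation`

Proves the support item `SplitGlue` (stmt-SmoothPoincare4-18066, support, rank 9) of
route-SmoothPoincare4-OneStabInvertible:
`InvertibleOfOneStab → InvertibleStandard → StabCancellation`
(stmt-SmoothPoincare4-18064 → 18065 → 16193, the route's target).

Pure logic (per homotopy 4-sphere `M` with one stabilisation `M # S²×S² ≅ S²×S²`: `InvertibleOfOneStab` produces an
inverse `M'` with `M # M' ≅ S⁴`, `InvertibleStandard` concludes `M ≅ S⁴`) — the same two lines as the route's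
`closes`, with the stabilisation as a hypothesis instead of `StabOneSuffices`. Root decomposition cell decomp-sp4
(D-0178), LANDING LIST 2 (writer g6); 0 sorry. Nothing here proves `SmoothPoincare4`.
-/

set_option linter.dupNamespace false

namespace Summit.SmoothPoincare4.SmoothPoincare4.Theorems.OneStabInvertibleSplitGlue

open Summit.SmoothPoincare4.SmoothPoincare4.Theses.OneStabInvertible

/-- Item stmt-SmoothPoincare4-18066: invertibility from one stabilisation + standardness of invertible homotopy
spheres give cancellation of the stabilisation. -/
theorem splitGlue_holds : SplitGlue := by
  intro h₁ h₂ M _ _ _ _ _ e hst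
  obtain ⟨M', _, _, _, _, _, hcs⟩ := h₁ M e hst
  exact h₂ M e M' hcs

end Summit.SmoothPoincare4.SmoothPoincare4.Theorems.OneStabInvertibleSplitGlue
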